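import Summits.BirchSwinnertonDyer.BirchSwinnertonDyer.Theorems.ClassRecordThreeEulerHalvesAtThreeEichlerShimuraTorsionCountK
import Literature.Geometry.Kaehler.RiemannSurfaceFirstHomologyPeriods
import Mathlib.Topology.Homotopy.Lifting
import Mathlib.AlgebraicTopology.FundamentalGroupoid.SimplyConnected
import Mathlib.Analysis.Complex.UpperHalfPlane.Topology
import HarnessLib

/-!
# The torsion-refined Shapiro count, part M: (SIGᶜ-lift)(ii) REDUCED TO A KERNEL-COVER TOWER — orbit classes in `π₁` of an orbit space,
# their monodromy through an equivariant map to a quotient covering, and the integral lift through `π₁(X)ᵃᵇ ≅ ℤ^{2g}`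

Helper file (route `ClassRecordThree`, crux `EulerHalvesAtThree` item 19109 → node `CartanOnePlaceDegreeLawAtThree` item 24801, print residue
(SIGᶜ-lift)(ii) = conjunct 4 `htors` of the keyed line `Lines/petarea.lean` rev 5; seat bsd-idea-10 g25, lens transfer, `--supports
stmt-BirchSwinnertonDyer-19109 --as helper`). Part K isolated the residue as the torsion-null lifting clause `htors` at division algebras; part L proved
it from a surface-group quotient `ι(O¹) ↠ π₁(Σ_g)` (Poincaré's presentation, displayed as a hypothesis). This part gives the SECOND, presentation-free
road — the covering-space road of Armstrong (1968) ∕ Hatcher §1.3, abelianised — and proves everything on it except the Riemann-surface packaging of the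
tower `ℍ → Y_ψ → X = Γ∖ℍ`, which is displayed as the hypothesis `tower` (§3) in Mathlib's own vocabulary (`IsQuotientCoveringMap`, `ChartedSpace ℂ`,
`IsManifold 𝓘(ℂ) ω`, `CompactSpace`):

* §1 (pure topology, any group `Γ` acting by homeomorphisms on a simply connected space `E`, any continuous `Γ`-invariant `P : E → X`): the ORBIT CLASS
  `L(γ) = [P ∘ (z₀ ⇝ γ • z₀)] ∈ π₁(X, P z₀)` of `γ` — written out in every statement as `FundamentalGroup.fromPath ⟦(p.map P).cast …⟧`, no auxiliary
  definition — is independent of the path (`orbitClass_eq`), ANTI-multiplicative (`orbitClass_mul`: `L(γδ) = L(δ)·L(γ)`, Mathlib's composition order in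
  `FundamentalGroup`), trivial on every element with a fixed point and on the subgroup they generate (`orbitClass_eq_one_of_smul_eq`,
  `orbitClass_eq_one_of_mem_closure` — the easy inclusion of Armstrong's theorem `π₁(E∕Γ) ≅ Γ∕⟨fixed-point elements⟩`), and — the load-bearing
  identity — if `P = π ∘ q` for a quotient covering
  `π : Y → X = Y∕A` (Mathlib `IsQuotientCoveringMap π A`) and a continuous `τ`-equivariant `q : E → Y` (`q (γ • z) = τ γ • q z`), then Mathlib's monodromy
  character takes the value `τ γ` on the orbit class of `γ` (`fundamentalGroupToMulOpposite_orbitClass`; Hatcher Prop. 1.39∕1.40 with the lifting criterion).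
* §2 (pure algebra + §1): characters `G → ZMod n` of a group with `Gᵃᵇ ≅ ℤ^ι`, `ι` finite, lift to `ℤ` (`exists_int_lift_of_abelianization_addEquiv_pi`);
  hence the ABSTRACT KERNEL-COVER LIFT `exists_int_lift_of_tower`: given the tower `E —q→ Y —π→ X` as in §1, `π₁(X, π(q z₀))ᵃᵇ ≅ ℤ^ι`, and a character
  `χ : A →* ZMod n` with `χ ∘ τ = ψ`, the function `ψ : Γ → ZMod n` lifts to an ADDITIVE `u : Γ → ℤ` (`u = m̃ ∘ L`, `m̃` an integral lift of `χ ∘ monodromy`).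
  No hypothesis on `ψ` is needed here: additivity of `u` comes from §1, and torsion-nullity of `ψ` is what a CONSTRUCTION of the tower consumes (below).
* §3 (the family `Γ = ι(O¹) = normOneUnits ι hO` acting on `ℍ`, which is simply connected — Mathlib): `torsLift_of_tower` (one `ψ`), `torsLift_of_towers`
  (conjunct 4 `htors` of petarea rev 5 ∕ the hypothesis of part K's `parabolicCochain_modLift_of_torsLift`, from a tower for every torsion-null additive `ψ`
  at every division `B`), `parabolicCochain_modLift_of_towers` (hence the print fact (SIGᶜ-lift) itself, via part K). Here `π₁(X)ᵃᵇ ≅ ℤ^{2g}` is the tree's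
  `RiemannSurface.nonempty_abelianization_addEquiv_pi` for the compact Riemann surface `X`.

WHAT REMAINS for an in-tree proof of `htors` on this road (not claimed here; bricks for a prover, all over existing tree∕Mathlib declarations): for `B` a
division algebra, `Γ = ι(O¹)`, `ψ : Γ → ZMod n` additive and torsion-null, `K_ψ = ker ψ` (normal, finite index, containing every finite-order element, so
every stabiliser `Γ_z` — `CartanCover.PrintClauses.finite_stabilizer` — and `±1`): (T-a) a torsion-free normal `Γ₂ ≤ K_ψ` of finite index
(`…PrintClausesTorsionFree` ∕ `exists_torsionFree_level_subgroup`) and the compact Riemann surface `Y₂ = Γ₂∖ℍ` (`CartanCover.PrintClauses.isManifold_orbitQuotient`,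
cocompactness from `QuaternionOrderUnitsCocompact`); (T-b) the finite groups `K_ψ∕Γ₂{±1} ⊴ Γ∕Γ₂{±1}` acting holomorphically and effectively on `Y₂`, the orbit
surfaces `Y_ψ = OrbitSurface _ Y₂`, `X = OrbitSurface _ Y₂` (`Literature.Geometry.Kaehler.RiemannSurfaceQuotient…`, `…IntermediateOrbitSurfaces…`); (T-c) the
factor map `π : Y_ψ → X` is a quotient covering for the FREE action of `A = Γ∕K_ψ` (free because `ψ` kills stabilisers — this is where torsion-nullity is
spent); (T-d) `q : ℍ → Y₂ → Y_ψ` is continuous and `τ`-equivariant for `τ : Γ → A` the quotient map, and `χ = ψ̄ : A ↪ ZMod n`. Then `torsLift_of_tower`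
closes `htors` for that `ψ`. (At `D = 1` the same §1–§2 apply verbatim to the open surface `Γ∖ℍ`, whose `π₁ᵃᵇ` is free as well; the parabolic clause is then
the extra input — not treated here.)

Relation to the crux-idea card `Cruxes/CartanOnePlaceDegreeLawAtThree/Ideas/kercover.md` (cruxidea seat g8, unregistered line `Lines/kercover.lean`): its
content stub KERCOV-div asks for `(X, Φ : Γ →* π₁(X, x₀), m)` with `m ∘ Φ = ψ`; §1–§2 here supply `Φ` (the orbit class, anti-multiplicative — harmless
for abelian coefficients) and `m` (monodromy ∘ `χ`) from the tower (T-a)–(T-d), and prove the compatibility, so KERCOV-div too is reduced to the tower.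
Theorems only: no definition, no instance, no notation, no named fact, no `sorry`. Nothing about NUM, (M),
(KTYPE), (PET) or any curve is proved; no summit statement is proved; BSD is proved for no curve.

## References
* A. Hatcher, *Algebraic Topology*, CUP (2002), §1.1 Prop. 1.5 p. 28 (change of basepoint), Prop. 1.33 (lifting criterion), Prop. 1.39–1.40 pp. 71–72
  (deck transformations and the monodromy of a normal covering `π₁(X) → G(Ỹ)`), §1.2 Cor. 1.27 p. 51 (`π₁(M_g)ᵃᵇ = ℤ^{2g}` distinguishes the `M_g`);
  held copy `book:hatchernd-algebraic-topology` PDF pp. 40, 72, 97, 99. [HatcherAT2002]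
* M. A. Armstrong, The fundamental group of the orbit space of a discontinuous group, *Proc. Cambridge Philos. Soc.* 64 (1968) 299–301, Theorem p. 299
  (`π₁(E∕Γ) ≅ Γ∕H`, `H` generated by the elements with fixed points; §1 proves `H ≤ ker`). [Armstrong1968]
* R. Brown, *Topology and Groupoids* (2006), 11.5.2 (the orbit morphism `Γ → π₁(E∕Γ)`). [Brown2006]
* H. M. Farkas, I. Kra, *Riemann Surfaces*, GTM 71, 2nd ed. (1992), I.2.5 (`H₁ = ℤ^{2g}`), III.9.3 (characters determined by values on a homology basis).
  [FarkasKra1992]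
* G. Shimura, *Introduction to the Arithmetic Theory of Automorphic Functions* (1971), §1.5 Prop. 1.16–1.19, §8.2 (8.2.6) p. 232, §9.2 p. 246. [ShimuraIATAF1971]
-/

set_option linter.dupNamespace false
set_option autoImplicit false

noncomputable section

open scoped unitInterval Manifold ContDiff MatrixGroups
open Function Multiplicative

namespace Summit.BirchSwinnertonDyer.BirchSwinnertonDyer.Theorems.EichlerShimuraLevelM

open Literature.NumberTheory.Automorphic

/-! ## §1 Orbit classes in `π₁` of an orbit space and their monodromy (pure topology) -/

namespace OrbitLoop

variable {Γ : Type*} [Group Γ] {E : Type*} [TopologicalSpace E] [MulAction Γ E]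
  [SimplyConnectedSpace E] {X : Type*} [TopologicalSpace X]

/-- In a simply connected space the images under a continuous map of any two paths with the same endpoints, recast to any endpoints, define the
same homotopy class. [cite: HatcherAT2002, §1.1 Prop. 1.5 p. 28] -/
theorem mk_map_cast_eq {a b : E} (p p' : Path a b) (P : C(E, X)) {x y : X} (hx : x = P a) (hy : y = P b) :
    (Path.Homotopic.Quotient.mk ((p.map P.continuous).cast hx hy)) =
      Path.Homotopic.Quotient.mk ((p'.map P.continuous).cast hx hy) :=
  Path.Homotopic.Quotient.eq.mpr (((SimplyConnectedSpace.paths_homotopic p p').map P).pathCast hx hy)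

variable (P : C(E, X)) (hP : ∀ (γ : Γ) (z : E), P (γ • z) = P z) (z₀ : E)

/-! Throughout, the ORBIT CLASS of `γ ∈ Γ` computed on a path `p : z₀ ⇝ γ • z₀` is the element
`FundamentalGroup.fromPath ⟦(p.map P.continuous).cast rfl (hP γ z₀).symm⟧ ∈ π₁(X, P z₀)` — the class of the image loop (Brown's orbit morphism,
11.5.2). It is written out in full in every statement (no auxiliary definition), and is independent of `p`: -/

/-- **The orbit class is independent of the path** `z₀ ⇝ γ • z₀` (`E` is simply connected). [cite: HatcherAT2002, §1.1 Prop. 1.5 p. 28] [cite: Brown2006, 11.5.2] -/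
theorem orbitClass_eq (γ : Γ) (p p' : Path z₀ (γ • z₀)) :
    FundamentalGroup.fromPath (Path.Homotopic.Quotient.mk ((p.map P.continuous).cast rfl (hP γ z₀).symm)) =
      FundamentalGroup.fromPath (Path.Homotopic.Quotient.mk ((p'.map P.continuous).cast rfl (hP γ z₀).symm)) := by
  rw [mk_map_cast_eq]

variable [ContinuousConstSMul Γ E]

/-- **Orbit classes are anti-multiplicative**: `L(γδ) = L(δ) · L(γ)` in Mathlib's `FundamentalGroup` (whose product `p * q` is "`q` then `p`"), for ANY
choice of the three paths; computed on the path `z₀ ⇝ γ z₀ ⇝ γ δ z₀` obtained by translating `z₀ ⇝ δ z₀` by `γ`. [cite: Brown2006, 11.5.2]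
[cite: Armstrong1968, Theorem p. 299] -/
theorem orbitClass_mul (γ δ : Γ) (pγ : Path z₀ (γ • z₀)) (pδ : Path z₀ (δ • z₀)) (pγδ : Path z₀ ((γ * δ) • z₀)) :
    FundamentalGroup.fromPath (Path.Homotopic.Quotient.mk ((pγδ.map P.continuous).cast rfl (hP (γ * δ) z₀).symm)) =
      FundamentalGroup.fromPath (Path.Homotopic.Quotient.mk ((pδ.map P.continuous).cast rfl (hP δ z₀).symm)) *
        FundamentalGroup.fromPath (Path.Homotopic.Quotient.mk ((pγ.map P.continuous).cast rfl (hP γ z₀).symm)) := by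
  -- replace `pγδ` by `pγ` followed by the `γ`-translate of `pδ`
  let p : Path z₀ ((γ * δ) • z₀) := pγ.trans (((pδ.map (continuous_const_smul γ))).cast rfl (mul_smul γ δ z₀))
  rw [orbitClass_eq P hP z₀ (γ * δ) pγδ p]
  have hpath : (p.map P.continuous).cast rfl (hP (γ * δ) z₀).symm =
      ((pγ.map P.continuous).cast rfl (hP γ z₀).symm).trans ((pδ.map P.continuous).cast rfl (hP δ z₀).symm) := by
    ext t
    simp only [Path.cast_coe, Path.map_coe, Path.trans_apply, Function.comp_apply, p]
    split_ifs with h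
    · rfl
    · simp [hP]
  rw [hpath, Path.Homotopic.Quotient.mk_trans, FundamentalGroup.mul_def]

/-- The orbit class of `1` is trivial (any path `z₀ ⇝ 1 • z₀`). [folklore] -/
theorem orbitClass_one (p : Path z₀ ((1 : Γ) • z₀)) :
    FundamentalGroup.fromPath (Path.Homotopic.Quotient.mk ((p.map P.continuous).cast rfl (hP 1 z₀).symm)) = 1 := by
  have h := orbitClass_mul P hP z₀ 1 1 p p (p.cast rfl (by rw [mul_one]))
  have h' : FundamentalGroup.fromPath (Path.Homotopic.Quotient.mk (((p.cast rfl (by rw [mul_one]) : Path z₀ (((1 : Γ) * 1) • z₀)).map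
      P.continuous).cast rfl (hP (1 * 1) z₀).symm)) =
      FundamentalGroup.fromPath (Path.Homotopic.Quotient.mk ((p.map P.continuous).cast rfl (hP 1 z₀).symm)) := by
    congr 1
  rw [h'] at h
  exact mul_left_cancel (h.symm.trans (mul_one _).symm)

/-- **An element with a fixed point has trivial orbit class** (the easy inclusion of Armstrong's theorem): along `z₀ ⇝ w = γ w ⇝ γ z₀` (the second
half the `γ`-translate of the reversed first) the image loop is `α · α⁻¹`. [cite: Armstrong1968, Theorem p. 299] [cite: Brown2006, 11.5.2] -/
theorem orbitClass_eq_one_of_smul_eq (γ : Γ) {w : E} (hw : γ • w = w) (p : Path z₀ (γ • z₀)) :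
    FundamentalGroup.fromPath (Path.Homotopic.Quotient.mk ((p.map P.continuous).cast rfl (hP γ z₀).symm)) = 1 := by
  let α := PathConnectedSpace.somePath z₀ w
  -- the path `z₀ ⇝ w = γ • w ⇝ γ • z₀`
  let p' : Path z₀ (γ • z₀) := α.trans ((α.symm.map (continuous_const_smul γ)).cast hw.symm rfl)
  rw [orbitClass_eq P hP z₀ γ p p']
  have hpath : (p'.map P.continuous).cast rfl (hP γ z₀).symm = (α.map P.continuous).trans (α.map P.continuous).symm := by
    ext t
    simp only [Path.cast_coe, Path.map_coe, Path.trans_apply, Function.comp_apply, p']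
    split_ifs with h
    · rfl
    · simp [hP]
  rw [hpath, FundamentalGroup.one_def, ← Path.Homotopic.Quotient.mk_refl]
  exact congrArg FundamentalGroup.fromPath (Path.Homotopic.Quotient.eq.mpr ⟨(Path.Homotopy.reflTransSymm _).symm⟩)

/-- Every element of the subgroup generated by the elements having a fixed point has trivial orbit class (on any path).
[cite: Armstrong1968, Theorem p. 299] -/
theorem orbitClass_eq_one_of_mem_closure (γ : Γ) (hγ : γ ∈ Subgroup.closure {g : Γ | ∃ w : E, g • w = w}) (p : Path z₀ (γ • z₀)) :
    FundamentalGroup.fromPath (Path.Homotopic.Quotient.mk ((p.map P.continuous).cast rfl (hP γ z₀).symm)) = 1 := by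
  induction hγ using Subgroup.closure_induction with
  | mem g hg => obtain ⟨w, hw⟩ := hg; exact orbitClass_eq_one_of_smul_eq P hP z₀ g hw p
  | one => exact orbitClass_one P hP z₀ p
  | mul g h _ _ ihg ihh =>
      rw [orbitClass_mul P hP z₀ g h (PathConnectedSpace.somePath _ _) (PathConnectedSpace.somePath _ _) p, ihg, ihh, mul_one]
  | inv g _ ih =>
      have h1 := orbitClass_mul P hP z₀ g g⁻¹ (PathConnectedSpace.somePath _ _) p (PathConnectedSpace.somePath _ _)
      rw [ih, mul_one] at h1
      -- `L(g g⁻¹) = 1`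
      have h2 : FundamentalGroup.fromPath (Path.Homotopic.Quotient.mk (((PathConnectedSpace.somePath z₀ ((g * g⁻¹) • z₀)).map
          P.continuous).cast rfl (hP (g * g⁻¹) z₀).symm)) = 1 := by
        have hmem : g * g⁻¹ ∈ Subgroup.closure {g : Γ | ∃ w : E, g • w = w} := by rw [mul_inv_cancel]; exact one_mem _
        -- `g * g⁻¹ = 1` has every point fixed
        exact orbitClass_eq_one_of_smul_eq P hP z₀ (g * g⁻¹) (w := z₀) (by rw [mul_inv_cancel, one_smul]) _
      rw [h2] at h1
      exact h1.symm

variable {Y : Type*} [TopologicalSpace Y] {A : Type*} [Group A] [MulAction A Y] {π : Y → X}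

omit [ContinuousConstSMul Γ E] [SimplyConnectedSpace E] in
/-- **Monodromy of an orbit class.** If `P = π ∘ q` for a quotient covering `π : Y → X = Y∕A` and a continuous `q : E → Y` that is `τ`-equivariant
(`q (γ • z) = τ γ • q z`), then Mathlib's monodromy character `π₁(X, P z₀) → Aᵐᵒᵖ` (based at `q z₀`) takes the value `τ γ` on the orbit class of `γ`
(on any path `p`): the lift of the image loop from `q z₀` is `q ∘ p`, ending at `q (γ z₀) = τ γ • q z₀`. [cite: HatcherAT2002, Prop. 1.39 and Prop. 1.40] -/
theorem fundamentalGroupToMulOpposite_orbitClass (hπ : IsQuotientCoveringMap π A) (q : C(E, Y)) (τ : Γ → A)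
    (hq : ∀ (γ : Γ) (z : E), q (γ • z) = τ γ • q z) (hPq : ∀ z, π (q z) = P z) (γ : Γ) (p : Path z₀ (γ • z₀)) :
    hπ.fundamentalGroupToMulOpposite ⟨q z₀, hPq z₀⟩
        (FundamentalGroup.fromPath (Path.Homotopic.Quotient.mk ((p.map P.continuous).cast rfl (hP γ z₀).symm))) =
      MulOpposite.op (τ γ) := by
  rw [IsQuotientCoveringMap.fundamentalGroupToMulOpposite_apply_eq_Iff]
  have hmono : hπ.isCoveringMap.monodromy
      (FundamentalGroup.fromPath (Path.Homotopic.Quotient.mk ((p.map P.continuous).cast rfl (hP γ z₀).symm))) ⟨q z₀, hPq z₀⟩ =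
      ⟨q (γ • z₀), (hPq (γ • z₀)).trans (hP γ z₀)⟩ := by
    refine hπ.isCoveringMap.monodromy_eq_of_map_eq (Path.Homotopic.Quotient.mk (p.map q.continuous)) ?_
    rw [← Path.Homotopic.Quotient.mk_map]
    change _ = (Path.Homotopic.Quotient.mk _).cast _ _
    rw [← Path.Homotopic.Quotient.mk_cast]
    congr 1
    ext t
    simp only [Path.cast_coe, Path.map_coe, Function.comp_apply, ContinuousMap.coe_mk]
    exact hPq _
  rw [hmono, MulOpposite.unop_op]
  exact (hq γ z₀).symm

end OrbitLoop

/-! ## §2 The integral lift through a free abelianisation, and the abstract kernel-cover lift -/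

open OrbitLoop

/-- **Characters `G → ZMod n` of a group whose abelianisation is free of finite rank lift to `ℤ`**: with `Gᵃᵇ ≅ ℤ^ι` fixed, lift the values on the
standard basis along `ℤ ↠ ZMod n` and extend linearly. [cite: FarkasKra1992, III.9.3] [cite: HatcherAT2002, §1.2 Cor. 1.27 p. 51] -/
theorem exists_int_lift_of_abelianization_addEquiv_pi {G : Type*} [Group G] {ι : Type*} [Finite ι]
    (e : Additive (Abelianization G) ≃+ (ι → ℤ)) {n : ℕ} (m : G →* Multiplicative (ZMod n)) :
    ∃ mZ : G →* Multiplicative ℤ, ∀ g : G, ((toAdd (mZ g) : ℤ) : ZMod n) = toAdd (m g) := by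
  classical
  letI := Fintype.ofFinite ι
  -- `m` as an additive map on `ι → ℤ`
  let f₀ : Additive (Abelianization G) →+ ZMod n := MonoidHom.toAdditiveLeft (Abelianization.lift m)
  let f : (ι → ℤ) →+ ZMod n := f₀.comp e.symm.toAddMonoidHom
  -- lift the values on the standard basis
  have hz : ∀ i : ι, ∃ z : ℤ, (z : ZMod n) = f (Pi.single i 1) := fun i => ZMod.intCast_surjective _
  choose z hz using hz
  let F : (ι → ℤ) →+ ℤ :=
    { toFun := fun x => ∑ i, x i * z i
      map_zero' := by simp
      map_add' := fun x y => by simp [add_mul, Finset.sum_add_distrib] }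
  have hF : ∀ x : ι → ℤ, ((F x : ℤ) : ZMod n) = f x := by
    intro x
    have hx : f x = ∑ i, (x i : ZMod n) * f (Pi.single i 1) := by
      conv_lhs => rw [← Finset.univ_sum_single x]
      rw [map_sum]
      refine Finset.sum_congr rfl fun i _ => ?_
      have : Pi.single i (x i) = x i • (Pi.single i (1 : ℤ) : ι → ℤ) := by
        rw [← Pi.single_smul', smul_eq_mul, mul_one]
      rw [this, map_zsmul, zsmul_eq_mul]
    rw [hx]
    simp [F, hz]
  let mZ : G →* Multiplicative ℤ := (AddMonoidHom.toMultiplicativeRight (F.comp e.toAddMonoidHom)).comp Abelianization.of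
  refine ⟨mZ, fun g => ?_⟩
  have h1 : (toAdd (mZ g) : ℤ) = F (e (Additive.ofMul (Abelianization.of g))) := by
    simp [mZ, AddMonoidHom.coe_toMultiplicativeRight]
  have h2 : toAdd (m g) = f (e (Additive.ofMul (Abelianization.of g))) := by
    simp [f, f₀, MonoidHom.coe_toAdditiveLeft]
  rw [h1, h2, hF]

/-- **ABSTRACT KERNEL-COVER LIFT.** Let `Γ` act by homeomorphisms on a simply connected `E`, let `π : Y → X = Y∕A` be a quotient covering and
`q : E → Y` continuous and `τ`-equivariant, and suppose `π₁(X, π(q z₀))ᵃᵇ ≅ ℤ^ι` with `ι` finite. Then every `ψ : Γ → ZMod n` that factors as `χ ∘ τ`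
for a character `χ : A →* ZMod n` lifts to an ADDITIVE `u : Γ → ℤ`: `u = m̃ ∘ L` with `L` the orbit class (§1), `m = χ ∘ monodromy` and `m̃` its integral
lift (`exists_int_lift_of_abelianization_addEquiv_pi`); `m ∘ L = ψ` is `fundamentalGroupToMulOpposite_orbitClass`.
[cite: HatcherAT2002, Prop. 1.39 and Prop. 1.40] [cite: Armstrong1968, Theorem p. 299] -/
theorem exists_int_lift_of_tower {Γ : Type*} [Group Γ] {E : Type*} [TopologicalSpace E] [MulAction Γ E]
    [ContinuousConstSMul Γ E] [SimplyConnectedSpace E] {X : Type*} [TopologicalSpace X]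
    {Y : Type*} [TopologicalSpace Y] {A : Type*} [Group A] [MulAction A Y] {π : Y → X}
    (hπ : IsQuotientCoveringMap π A) (q : C(E, Y)) (τ : Γ → A) (hq : ∀ (γ : Γ) (z : E), q (γ • z) = τ γ • q z)
    (z₀ : E) {ι : Type*} [Finite ι]
    (e : Additive (Abelianization (FundamentalGroup X (π (q z₀)))) ≃+ (ι → ℤ))
    {n : ℕ} (ψ : Γ → ZMod n) (χ : A →* Multiplicative (ZMod n)) (hχ : ∀ γ : Γ, χ (τ γ) = ofAdd (ψ γ)) :
    ∃ u : Γ → ℤ, (∀ γ δ : Γ, u (γ * δ) = u γ + u δ) ∧ ∀ γ : Γ, (u γ : ZMod n) = ψ γ := by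
  -- the invariant map `P = π ∘ q`
  let P : C(E, X) := ⟨π ∘ q, hπ.continuous.comp q.continuous⟩
  have hP : ∀ (γ : Γ) (z : E), P (γ • z) = P z := fun γ z => by
    simp only [P, ContinuousMap.coe_mk, Function.comp_apply, hq, hπ.map_smul]
  have hPq : ∀ z, π (q z) = P z := fun z => rfl
  -- the orbit classes (on chosen paths) and the monodromy character
  let pth : ∀ γ : Γ, Path z₀ (γ • z₀) := fun γ => PathConnectedSpace.somePath z₀ (γ • z₀)
  let L : Γ → FundamentalGroup X (P z₀) := fun γ =>
    FundamentalGroup.fromPath (Path.Homotopic.Quotient.mk (((pth γ).map P.continuous).cast rfl (hP γ z₀).symm))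
  let Fm := hπ.fundamentalGroupToMulOpposite ⟨q z₀, hPq z₀⟩
  let χ' : Aᵐᵒᵖ →* Multiplicative (ZMod n) :=
    (MulOpposite.opMulEquiv (M := Multiplicative (ZMod n))).symm.toMonoidHom.comp (MonoidHom.op χ)
  have hχ' : ∀ a : A, χ' (MulOpposite.op a) = χ a := fun a => by simp [χ']
  let m : FundamentalGroup X (P z₀) →* Multiplicative (ZMod n) := χ'.comp Fm
  have hm : ∀ γ : Γ, m (L γ) = ofAdd (ψ γ) := fun γ => by
    simp only [m, L, Fm, MonoidHom.coe_comp, Function.comp_apply]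
    rw [fundamentalGroupToMulOpposite_orbitClass P hP z₀ hπ q τ hq hPq γ (pth γ), hχ', hχ]
  -- lift `m` to `ℤ` and pull back along `L`
  have e' : Additive (Abelianization (FundamentalGroup X (P z₀))) ≃+ (ι → ℤ) := e
  obtain ⟨mZ, hmZ⟩ := exists_int_lift_of_abelianization_addEquiv_pi e' m
  refine ⟨fun γ => toAdd (mZ (L γ)), fun γ δ => ?_, fun γ => ?_⟩
  · change toAdd (mZ (L (γ * δ))) = toAdd (mZ (L γ)) + toAdd (mZ (L δ))
    simp only [L]
    rw [orbitClass_mul P hP z₀ γ δ (pth γ) (pth δ) (pth (γ * δ)), map_mul, toAdd_mul, add_comm]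
  · exact (hmZ (L γ)).trans (by rw [hm γ, toAdd_ofAdd])

/-! ## §3 The family `Γ = ι(O¹)` on `ℍ`: (SIGᶜ-lift)(ii) from kernel-cover towers -/

/-- **ONE COCHAIN.** For `Γ = ι(O¹) = normOneUnits ι hO` acting on `ℍ` (simply connected — Mathlib) and `ψ : Γ → ZMod n`: a KERNEL-COVER TOWER for
`ψ` — a compact connected Riemann surface `X`, a quotient covering `π : Y → X = Y∕A`, a continuous `τ`-equivariant `q : ℍ → Y` and a character
`χ : A →* ZMod n` with `χ ∘ τ = ψ` — yields an additive integral lift of `ψ`. (`π₁(X)ᵃᵇ ≅ ℤ^{2g}`: tree `RiemannSurface.nonempty_abelianization_addEquiv_pi`.)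
Intended tower: `Y = ker ψ∖ℍ`, `X = Γ∖ℍ`, `A = Γ∕ker ψ` (free on `Y` when `ψ` is torsion-null), `q` the projection — see the file header, (T-a)–(T-d).
[cite: ShimuraIATAF1971, §1.5 Prop. 1.16–1.19 and §9.2 p. 246] [cite: HatcherAT2002, Prop. 1.40] [cite: FarkasKra1992, I.2.5] -/
theorem torsLift_of_tower (B : Type) [Ring B] [Algebra ℚ B] [IsQuaternionAlgebra ℚ B] (O : Submodule ℤ B)
    (hO : Brandt.IsOrder B O) (ι : B →ₐ[ℚ] Matrix (Fin 2) (Fin 2) ℝ) (n : ℕ) (ψ : normOneUnits ι hO → ZMod n)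
    (tower : ∃ (X : Type) (_ : TopologicalSpace X) (_ : ChartedSpace ℂ X) (_ : IsManifold 𝓘(ℂ, ℂ) ω X)
        (_ : CompactSpace X) (_ : T2Space X) (_ : ConnectedSpace X)
        (Y : Type) (_ : TopologicalSpace Y) (A : Type) (_ : Group A) (_ : MulAction A Y) (π : Y → X)
        (_ : IsQuotientCoveringMap π A) (q : C(UpperHalfPlane, Y)) (τ : normOneUnits ι hO → A) (χ : A →* Multiplicative (ZMod n)),
        (∀ (γ : normOneUnits ι hO) (z : UpperHalfPlane), q (γ • z) = τ γ • q z) ∧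
          ∀ γ : normOneUnits ι hO, χ (τ γ) = ofAdd (ψ γ)) :
    ∃ u : normOneUnits ι hO → ℤ,
      (∀ γ δ : normOneUnits ι hO, u (γ * δ) = u γ + u δ) ∧ ∀ γ : normOneUnits ι hO, (u γ : ZMod n) = ψ γ := by
  obtain ⟨X, _, _, _, _, _, _, Y, _, A, _, _, π, hπ, q, τ, χ, hq, hχ⟩ := tower
  haveI : ContinuousConstSMul (normOneUnits ι hO) UpperHalfPlane := ⟨fun γ => continuous_const_smul (γ : GL (Fin 2) ℝ)⟩
  obtain ⟨e⟩ := Literature.Geometry.Kaehler.RiemannSurface.nonempty_abelianization_addEquiv_pi (M := X) (π (q UpperHalfPlane.I))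
  exact exists_int_lift_of_tower hπ q τ hq UpperHalfPlane.I e ψ χ hχ

/-- **CONJUNCT 4 `htors` OF `Lines/petarea.lean` rev 5 FROM KERNEL-COVER TOWERS**: if every torsion-null additive `ψ : ι(O¹) → ZMod n` (`n ≠ 0`) at every
division indefinite `B` admits a kernel-cover tower, the torsion-null lifting clause of part K holds verbatim. [cite: ShimuraIATAF1971, §8.2 (8.2.6) p. 232 and §9.2 p. 246]
[cite: HatcherAT2002, Prop. 1.40] -/
theorem torsLift_of_towers
    (htower : ∀ (B : Type) [Ring B] [Algebra ℚ B] [IsQuaternionAlgebra ℚ B] (O : Submodule ℤ B) (hO : Brandt.IsOrder B O)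
      (ι : B →ₐ[ℚ] Matrix (Fin 2) (Fin 2) ℝ), Function.Injective ι → (∀ x : B, x ≠ 0 → IsUnit x) →
      ∀ (n : ℕ), n ≠ 0 → ∀ ψ : normOneUnits ι hO → ZMod n,
        (∀ γ δ : normOneUnits ι hO, ψ (γ * δ) = ψ γ + ψ δ) →
        (∀ γ : normOneUnits ι hO, IsOfFinOrder γ → ψ γ = 0) →
        ∃ (X : Type) (_ : TopologicalSpace X) (_ : ChartedSpace ℂ X) (_ : IsManifold 𝓘(ℂ, ℂ) ω X)
          (_ : CompactSpace X) (_ : T2Space X) (_ : ConnectedSpace X)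
          (Y : Type) (_ : TopologicalSpace Y) (A : Type) (_ : Group A) (_ : MulAction A Y) (π : Y → X)
          (_ : IsQuotientCoveringMap π A) (q : C(UpperHalfPlane, Y)) (τ : normOneUnits ι hO → A) (χ : A →* Multiplicative (ZMod n)),
          (∀ (γ : normOneUnits ι hO) (z : UpperHalfPlane), q (γ • z) = τ γ • q z) ∧
            ∀ γ : normOneUnits ι hO, χ (τ γ) = ofAdd (ψ γ)) :
    ∀ (B : Type) [Ring B] [Algebra ℚ B] [IsQuaternionAlgebra ℚ B] (O : Submodule ℤ B) (hO : Brandt.IsOrder B O)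
      (ι : B →ₐ[ℚ] Matrix (Fin 2) (Fin 2) ℝ), Function.Injective ι → (∀ x : B, x ≠ 0 → IsUnit x) →
      ∀ (n : ℕ), n ≠ 0 → ∀ ψ : normOneUnits ι hO → ZMod n,
        (∀ γ δ : normOneUnits ι hO, ψ (γ * δ) = ψ γ + ψ δ) →
        (∀ γ : normOneUnits ι hO, IsOfFinOrder γ → ψ γ = 0) →
        ∃ u : normOneUnits ι hO → ℤ,
          (∀ γ δ : normOneUnits ι hO, u (γ * δ) = u γ + u δ) ∧ ∀ γ : normOneUnits ι hO, (u γ : ZMod n) = ψ γ :=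
  fun B _ _ _ O hO ι hι hdiv n hn ψ hadd htor ↦ torsLift_of_tower B O hO ι n ψ (htower B O hO ι hι hdiv n hn ψ hadd htor)

/-- **(SIGᶜ-lift) FROM KERNEL-COVER TOWERS**: with part K's `parabolicCochain_modLift_of_torsLift` (split half proved in part J; no parabolic elements at
division algebras), towers for all torsion-null cochains give the print fact `parabolicCochain_modLift` itself. [cite: ShimuraIATAF1971, §8.2 (8.2.6) p. 232] -/
theorem parabolicCochain_modLift_of_towers
    (htower : ∀ (B : Type) [Ring B] [Algebra ℚ B] [IsQuaternionAlgebra ℚ B] (O : Submodule ℤ B) (hO : Brandt.IsOrder B O)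
      (ι : B →ₐ[ℚ] Matrix (Fin 2) (Fin 2) ℝ), Function.Injective ι → (∀ x : B, x ≠ 0 → IsUnit x) →
      ∀ (n : ℕ), n ≠ 0 → ∀ ψ : normOneUnits ι hO → ZMod n,
        (∀ γ δ : normOneUnits ι hO, ψ (γ * δ) = ψ γ + ψ δ) →
        (∀ γ : normOneUnits ι hO, IsOfFinOrder γ → ψ γ = 0) →
        ∃ (X : Type) (_ : TopologicalSpace X) (_ : ChartedSpace ℂ X) (_ : IsManifold 𝓘(ℂ, ℂ) ω X)
          (_ : CompactSpace X) (_ : T2Space X) (_ : ConnectedSpace X)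
          (Y : Type) (_ : TopologicalSpace Y) (A : Type) (_ : Group A) (_ : MulAction A Y) (π : Y → X)
          (_ : IsQuotientCoveringMap π A) (q : C(UpperHalfPlane, Y)) (τ : normOneUnits ι hO → A) (χ : A →* Multiplicative (ZMod n)),
          (∀ (γ : normOneUnits ι hO) (z : UpperHalfPlane), q (γ • z) = τ γ • q z) ∧
            ∀ γ : normOneUnits ι hO, χ (τ γ) = ofAdd (ψ γ)) :
    parabolicCochain_modLift :=
  EichlerShimuraLevelK.parabolicCochain_modLift_of_torsLift (torsLift_of_towers htower)

end Summit.BirchSwinnertonDyer.BirchSwinnertonDyer.Theorems.EichlerShimuraLevelM
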